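import Literature.IUT.HodgeArakelov.AbsTopMonoidsGenuineProducer
import Literature.IUT.HodgeArakelov.GaloisPairCyclotomesBridge
import Literature.AnabelianGeometry.AbsoluteAnabelian.GaloisCyclotomeZHatOne

/-!
# Bridge B12 × B9: the Cor. 1.11 (a) input `GalRigidityInput` at the GENUINE `AbsTopMonoids` — reduced to ONE
# naturality statement about the [AbsTopIII] Rmk. 3.2.1 isomorphism (NV-L6 row GalRigidityInput)

Mochizuki, *Inter-universal Teichmüller theory II*, §1, Cor. 1.11 (a), kurims manuscript (Dec. 2020) p. 49
ll. 9–21: "the cyclotomic rigidity isomorphism `μ_Ẑ(G) ⥲ μ_Ẑ(O^×(G))` obtained by applying to the MLF-Galois pair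
determined by `G ↷ O^⊳(G)` the algorithm applied to construct [the inverse of] the isomorphism `μ_Ẑ(M_TM) ⥲ μ_Ẑ(G)`
in [AbsTopIII], Remark 3.2.1" [claim: Mochizuki2012, status: disputed] (IUTchII §1 Cor 1.11, kurims p.49);
Mochizuki, *Topics in absolute anabelian geometry III*, Rmk. 3.2.1 p. 73, Cor. 1.10 (i)(a)(c) pp. 41–42
[cite: MochizukiAbsTopIII2015, Remark 3.2.1 p.73].

abc-iut cell, layer L6; seat abc-iut-w4-d030 (gen 2), NV-L6 WAVE row **NV-L6/GalRigidityInput** (posted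
NV-BLOCKED 2026-08-26T03:21:20Z: «needs a GENUINE `AbsTopMonoids S` + the NATURAL Rmk. 3.2.1 iso»). Since then:
* B9 (abc-iut-L6-t13 g4): the GENUINE-mod-`ε` producer `AbsTopMonoids.genuineOfModel S C ε hΔ hq`
  (`AbsTopMonoidsGenuineProducer`, p421397 ✓): `O^⊳(G) := 𝒪_k̄^⊳` with `G` acting through
  `theta C ε G : G ≅ Gal(k̄/k)`, `O^⊳(f) :=` THE lift `liftM C (phiOf C ε f)` of the induced topological automorphism
  `phiOf C ε f` of `Gal(k̄/k)` ([AbsTopIII] Prop. 3.2 (iv); `liftM_unique`);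
* L4 (abc-iut-w4-d045 / L4-t1 / L6-t11): the Rmk. 3.2.1 isomorphism FOR THE MODEL with the GROUP-THEORETIC
  `μ_Ẑ(G_k)` as target, `TorsionReciprocityData.cyclotomeNonzeroIntegersEquivMuZhat D :
  Λ((𝒪_k̄^⊳)ˣ) ⥲ μ_Ẑ(G_k)` (`GaloisCyclotomeZHatOne`, p420801 ✓; local class field theory
  `nonempty_torsionReciprocityData`, `mlfGaloisCyclotomeIsRootsOfUnity_holds` ✓).
THIS FILE (proof-only, witness built inside the theorem term) ASSEMBLES them at the standard closure
`C := MLFClosure.std k` (`k̄ := AlgebraicClosure k`, `Gal(k̄/k) =` Mathlib's `Field.absoluteGaloisGroup k` — by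
`rfl`): `bsGalTri G := μ_Ẑ(theta G) ≫ (Rmk. 3.2.1 iso)⁻¹ : μ_Ẑ(G) ⥲ Λ(O^×(G))`, and PROVES the naturality square of
`GalRigidityInput` for EVERY morphism `f : G ⟶ H` of `IsoClass G_k` (= every isomorphism of topological groups)
FROM the single statement (hypothesis `hnat`, the residual of record, OWNER L4 per abc-iut-L6-lead §F v1.19d (1)(e)
/ abc-iut-L6-t13 04:11:51Z):
  **(b) for every TOPOLOGICAL automorphism `φ` of `Gal(k̄/k)`, the Rmk. 3.2.1 iso intertwines `μ_Ẑ(φ)` with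
  `Λ(` THE `φ`-equivariant lift of `φ` to `𝒪_k̄^⊳ )`** — i.e. the LCFT cyclotome identification is natural in
  ALL automorphisms of the topological group `G_k` (not only the field-theoretic ones), which is exactly the
  group-theoreticity content of [AbsTopIII] Cor. 1.10 (b)(c) / Rmk. 3.2.1 (L6-t13's sketch: ψ̄_φ at each finite level
  is `Art_{φU}⁻¹ ∘ φ^ab ∘ Art_U`, so (b) is `levelArt_unique` bookkeeping over the landed reciprocity data).
Reduction used: `μ_Ẑ(theta H) ∘ μ_Ẑ(f) = μ_Ẑ(phiOf f) ∘ μ_Ẑ(theta G)` (functoriality of abc-iut-L4-t1's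
`muZhat.congr`, `congr_theta_galCyclotomeMap`). RESULT: `nonempty_galRigidityInput_genuineOfModel (hnat)` —
NV-L6/GalRigidityInput becomes «GENUINE modulo (b)», with (b) stated in L4's own vocabulary
(`TorsionReciprocityData.cyclotomeNonzeroIntegersEquivMuZhat`, `muZhat.congr`, `Genuine.liftM`). Nothing of
abc-iut-L6-t13 / w4-d024 / L4 is restated; no `def`/`instance`; nothing here bears on [IUTchIII] Cor. 3.12;
typed ≠ proved for (b).
-/

noncomputable section

namespace Literature.IUT.HodgeArakelov

open CategoryTheory Literature.AnabelianGeometry.AbsoluteAnabelian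
open Literature.AnabelianGeometry.EtaleTheta (cyclotome)

namespace AbsTopMonoids.Genuine

variable (k : Type) [Field k] [CharZero k] [ValuativeRel k] [TopologicalSpace k] [IsNonarchimedeanLocalField k]

/-- `Gal(k̄/k)` of the standard model closure is COMPACT (it is Mathlib's `Field.absoluteGaloisGroup k` with the
Krull topology, definitionally). [cite: MochizukiAbsTopIII2015, Definition 3.1 (i) p.66] -/
theorem compactSpace_stdGalois :
    CompactSpace (ModelMLFGaloisData.galois (MLFClosure.std k).k (MLFClosure.std k).K).tmPair.Pi :=
  inferInstanceAs (CompactSpace (Field.absoluteGaloisGroup k))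

variable {S : ThetaSetting.{0}} [CompactSpace S.Gk]
  (ε : S.Gk ≃ₜ* (ModelMLFGaloisData.galois (MLFClosure.std k).k (MLFClosure.std k).K).tmPair.Pi)

/-- **Functoriality of `μ_Ẑ` along the chosen identifications**: for `f : G ⟶ H` in `IsoClass G_k`,
`μ_Ẑ(theta H) ∘ μ_Ẑ(f) = μ_Ẑ(phiOf f) ∘ μ_Ẑ(theta G)` on `μ_Ẑ(G)` (`phiOf f = theta G⁻¹ ≫ f ≫ theta H`;
abc-iut-L4-t1's `muQZ.map_trans` / `muQZ.map_congr` componentwise). [claim: Mochizuki2012, status: disputed]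
(IUTchII §1 Cor 1.11, kurims p.49) -/
theorem congr_theta_galCyclotomeMap {G H : IsoClass S.Gk} (f : G ⟶ H) (x : G.galCyclotome) :
    (haveI := G.compactSpace_carrier
     haveI := H.compactSpace_carrier
     haveI := compactSpace_stdGalois k
     muZhat.congr (theta (MLFClosure.std k) ε H) (IsoClass.galCyclotomeMap f x) =
       muZhat.congr (phiOf (MLFClosure.std k) ε f) (muZhat.congr (theta (MLFClosure.std k) ε G) x)) := by
  haveI := G.compactSpace_carrier
  haveI := H.compactSpace_carrier
  haveI := compactSpace_stdGalois k
  refine Subtype.ext (funext fun n => ?_)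
  simp only [muZhat.coe_congr, muZhat.map_apply_coe, IsoClass.galCyclotomeMap_apply_coe, toAdd_ofAdd]
  rw [← muQZ.map_trans, ← muQZ.map_trans]
  congr 1
  exact muQZ.map_congr (fun z => by
    rw [ContinuousMulEquiv.trans_apply, ContinuousMulEquiv.trans_apply, phiOf_apply,
      ContinuousMulEquiv.symm_apply_apply]) _

variable (hΔ : ∀ f : S.PiX ≃ₜ* S.PiX, S.DeltaX.map f.toMulEquiv.toMonoidHom = S.DeltaX)
  (hq : Nonempty (TopGroup.quot S.PiX S.DeltaX ≃ₜ* S.Gk)) (D : TorsionReciprocityData k)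

/-- **NV-L6/GalRigidityInput at the GENUINE `AbsTopMonoids`, modulo the naturality (b) of the Rmk. 3.2.1 iso.**
For `A := AbsTopMonoids.genuineOfModel S (MLFClosure.std k) ε hΔ hq` (B9, abc-iut-L6-t13) and reciprocity data `D`
(L4), put `bsGalTri G := μ_Ẑ(theta G) ≫ (Λ((𝒪_k̄^⊳)ˣ) ⥲ μ_Ẑ(G_k))⁻¹ : μ_Ẑ(G) ⥲ Λ(O^×(G))`; IF the Rmk. 3.2.1 iso is
natural under THE lifts of all topological automorphisms `φ` of `Gal(k̄/k)` (`hnat`, hypothesis (b), L4-side), then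
`(bsGalTri, bsGalTri_natural)` inhabits abc-iut-w4-d024's `GalRigidityInput A` — the cited input (a) of
[IUTchII] Cor. 1.11 over the genuine monoids. [claim: Mochizuki2012, status: disputed] (IUTchII §1 Cor 1.11, kurims p.49) -/
theorem nonempty_galRigidityInput_genuineOfModel
    (hnat : haveI := compactSpace_stdGalois k
      ∀ (φ : (ModelMLFGaloisData.galois (MLFClosure.std k).k (MLFClosure.std k).K).tmPair.Pi ≃ₜ*
          (ModelMLFGaloisData.galois (MLFClosure.std k).k (MLFClosure.std k).K).tmPair.Pi)
        (y : muZhat (Field.absoluteGaloisGroup k)),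
        D.cyclotomeNonzeroIntegersEquivMuZhat.symm (muZhat.congr φ y) =
          cyclotome.map (Units.map (liftM (MLFClosure.std k) φ).toMonoidHom)
            (D.cyclotomeNonzeroIntegersEquivMuZhat.symm y)) :
    Nonempty (GalRigidityInput (AbsTopMonoids.genuineOfModel S (MLFClosure.std k) ε hΔ hq)) := by
  haveI := compactSpace_stdGalois k
  refine ⟨{ bsGalTri := fun G =>
              haveI := G.compactSpace_carrier
              (muZhat.congr (theta (MLFClosure.std k) ε G)).trans D.cyclotomeNonzeroIntegersEquivMuZhat.symm
            bsGalTri_natural := ?_ }⟩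
  intro G H f x
  haveI := G.compactSpace_carrier
  haveI := H.compactSpace_carrier
  change D.cyclotomeNonzeroIntegersEquivMuZhat.symm
      (muZhat.congr (theta (MLFClosure.std k) ε H) (IsoClass.galCyclotomeMap f x)) =
    cyclotome.map (Units.map (liftM (MLFClosure.std k) (phiOf (MLFClosure.std k) ε f)).toMonoidHom)
      (D.cyclotomeNonzeroIntegersEquivMuZhat.symm (muZhat.congr (theta (MLFClosure.std k) ε G) x))
  rw [congr_theta_galCyclotomeMap k ε f x]
  exact hnat (phiOf (MLFClosure.std k) ε f) _

end AbsTopMonoids.Genuine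

end Literature.IUT.HodgeArakelov

end
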